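import Literature.NumberTheory.EllipticCurves.BhargavaShankarCongruencePiecesBoundProofs
import Literature.NumberTheory.EllipticCurves.BhargavaShankarUpperSieveTypeReductionProofs
import Literature.NumberTheory.EllipticCurves.BinaryQuarticRealTypesProofs
import HarnessLib

/-!
# The upper half of Thm 2.12 for the three real types, and Cor. 1.2 from the local integrals alone
# (Bhargava–Shankar, Thms 2.1, 2.12, Cor. 1.2)

`Proofs` file (theorems only: no definitions, no named facts). Topic
`Literature/NumberTheory/EllipticCurves`; instantiates `BhargavaShankarCongruencePiecesBoundProofs`
(`eventually_classCount_le_of_pieces`) with the fundamental sets of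
`BhargavaShankarConeFamilies.lean` — the cones over `q_{1,τ}` (type `0`), over `c₂(s)` (type `2+`)
and over `q_{−1,τ}, q_{τ,2}, q_{τ,−2}` (type `1`) — using their coverage
(`exists_cone0/1/2_subst`), the uniqueness of cone points with given invariants
(`cone*_params_unique`, `cone1B/C/D_invariants`), the volumes `vol(B₁) = (8, 8, 8+12+12) μ(G₀)/135`
(`BhargavaShankarRegionVolume`) and the real stabiliser sizes `8, 8, 4`
(`BinaryQuarticRealStabilizer`, Lemma 2.2). The pieces are produced inside the proofs
(`exists_piece0`, `exists_piece2`, `exists_pieces1`); no definitions are introduced.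

Results:

* `upperCongruenceTypeCount` — **the upper halves of Bhargava–Shankar's Thm 2.12** (Thm 2.11 of
  `arXiv:1006.1002v2`) for the three types: for every modulus `N`, set of residues
  `S ⊆ (ℤ/Nℤ)⁵` with `GL₂(ℤ)`-invariant pull-back `S̃` and `ε > 0`, eventually in `X`,
  `N(V_ℤ^{(0)} ∩ S̃; X) ≤ (#S/N⁵ · (4/135) ζ(2)·2… ` precisely
  `≤ (#S/N⁵ · (4/135)(π²/6)·… + ε) X^{5/6}` — with the constants `4/135, 4/135, 32/135` times
  `π²/6` of Thm 2.1 for `V^{(0)}, V^{(2+)}, V^{(1)}`;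
* `averageRankLE_three_halves_of_localIntegrals` — combined with
  `averageRankLE_three_halves_of_upperCongruenceTypeCount`
  (`BhargavaShankarUpperSieveTypeReductionProofs`): **Cor. 1.2** (`limsup` of the average rank
  `≤ 3/2`) follows from the local integrals (F) `∫ φ_p dμ_p = |2¹⁰/3³|_p · M_p(V,F)` alone
  (equivalently, `…_setIntegral`, from Prop. 3.13 as printed).

## References

* M. Bhargava, A. Shankar, Ann. of Math. (2) 181 (2015) 191–242, Thm 2.1, §2.1 (Table 1),
  §2.3, §2.5 Thm 2.11 (arXiv:1006.1002v2 numbering; Thm 2.12 published), Cor. 1.2. [cite: BhargavaShankarAnnals2015, Thm 2.12 (published numbering) upper bound, with the constants of Thm 2.1; Cor. 1.2]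
-/

noncomputable section

open Real MeasureTheory Matrix Set Filter Topology
open scoped MatrixGroups ENNReal

namespace Literature.NumberTheory.EllipticCurves

namespace BinaryQuartic

open Literature.MeasureTheory.Group Literature.Algebra.EuclideanLattices

/-! ## Generic facts about families of pieces -/

section Generic

variable {K : ℕ} (D : Fin K → Piece)

/-- The sections of pieces separated by their invariants form a section set. [folklore] -/
theorem isSectionSet_sections_of_sep
    (hsep : ∀ (k k' : Fin K) (m m' τ τ' : ℝ), 0 < m → 0 < m' → τ ∈ (D k).T → τ' ∈ (D k').T →
      (m • (D k).C.c τ).I = (m' • (D k').C.c τ').I → (m • (D k).C.c τ).J = (m' • (D k').C.c τ').J → k = k')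
    (X : ℝ) : IsSectionSet (sections D X) := by
  refine ⟨?_, ?_⟩
  · rintro ℓ ⟨k, m, τ, hm, -, hτ, rfl⟩
    rw [disc_smul_real]
    exact mul_ne_zero (pow_ne_zero _ hm.ne') ((D k).hΔ τ hτ)
  · rintro ℓ ⟨k, m, τ, hm, -, hτ, rfl⟩ ℓ' ⟨k', m', τ', hm', -, hτ', rfl⟩ hI hJ
    obtain rfl := hsep k k' m m' τ τ' hm hm' hτ hτ' hI hJ
    obtain ⟨rfl, rfl⟩ := (D k).huniq m m' τ τ' hm hm' hτ hτ' hI hJ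
    rfl

/-- For a single piece the sections form a section set. [folklore] -/
theorem isSectionSet_sections_one (P : Piece) (X : ℝ) : IsSectionSet (sections (fun _ : Fin 1 => P) X) :=
  isSectionSet_sections_of_sep _ (fun k k' _ _ _ _ _ _ _ _ _ _ => Subsingleton.elim k k') X

/-- Sections over curves of positive discriminant have real stabilisers of size `8`. [cite: BhargavaShankarAnnals2015, Lemma 2.2 (arXiv:1006.1002v2 numbering)] -/
theorem eight_le_ncard_substStabilizer (hpos : ∀ (k : Fin K), ∀ τ ∈ (D k).T, 0 < ((D k).C.c τ).disc)
    (X : ℝ) : ∀ ℓ ∈ sections D X, 8 ≤ (substStabilizer ℓ).ncard := by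
  rintro ℓ ⟨k, m, τ, hm, -, hτ, rfl⟩
  rw [ncard_substStabilizer_of_disc_pos]
  rw [disc_smul_real]; exact mul_pos (by positivity) (hpos k τ hτ)

/-- Sections over curves of negative discriminant have real stabilisers of size `4`. [cite: BhargavaShankarAnnals2015, Lemma 2.2 (arXiv:1006.1002v2 numbering)] -/
theorem four_le_ncard_substStabilizer (hneg : ∀ (k : Fin K), ∀ τ ∈ (D k).T, ((D k).C.c τ).disc < 0)
    (X : ℝ) : ∀ ℓ ∈ sections D X, 4 ≤ (substStabilizer ℓ).ncard := by
  rintro ℓ ⟨k, m, τ, hm, -, hτ, rfl⟩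
  rw [ncard_substStabilizer_of_disc_neg]
  rw [disc_smul_real]; exact mul_neg_of_pos_of_neg (by positivity) (hneg k τ hτ)

/-- `vol(B₁) ≤ Σ_k vol(Ψ_k(box_k))`. [folklore] -/
theorem volume_real_B1set_le :
    volume.real (B1set D) ≤ ∑ k, volume.real (psi (D k).C.cone '' paramBox (D k).T) := by
  unfold B1set
  have hfin : ∀ k, volume (psi (D k).C.cone '' paramBox (D k).T) ≠ ⊤ := fun k =>
    (isBounded_psi_image (D k)).measure_lt_top.ne
  simp only [Measure.real]
  rw [← ENNReal.toReal_sum (fun k _ => hfin k)]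
  refine ENNReal.toReal_mono (ENNReal.sum_ne_top.2 fun k _ => hfin k) ?_
  exact measure_iUnion_fintype_le volume _

/-- **From a cone decomposition to membership in the sections**: if
`x_ℝ = (m · c_k(τ)) ∘ γ` with `det γ = ±1`, `m > 0`, `τ ∈ T_k`, the curve point has height `1`
and `H(x) < X`, then `m < X^{1/6}`, so `x` is `SL₂^±(ℝ)`-equivalent to a section of `𝓛_X`. [cite: BhargavaShankarAnnals2015, §2.1 and §2.3 (R_X = Λ L with H < X; arXiv:1006.1002v2 numbering)] -/
theorem exists_section_of_cone {x : BinaryQuartic ℤ} {k : Fin K} {m τ : ℝ} (hm : 0 < m) (hτ : τ ∈ (D k).T)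
    {γ : Matrix (Fin 2) (Fin 2) ℝ} (hγ : γ.det = 1 ∨ γ.det = -1)
    (hx : x.map (Int.castRingHom ℝ) = (m • (D k).C.c τ).subst γ)
    (hH1 : realHeightIJ ((D k).C.c τ).I ((D k).C.c τ).J = 1) {X : ℝ} (hH : x.height < X) :
    ∃ ℓ₀ ∈ sections D X, ∃ g₀ : Matrix (Fin 2) (Fin 2) ℝ, (g₀.det = 1 ∨ g₀.det = -1) ∧
      x.map (Int.castRingHom ℝ) = ℓ₀.subst g₀ := by
  refine ⟨m • (D k).C.c τ, ⟨k, m, τ, hm, ?_, hτ, rfl⟩, γ, hγ, hx⟩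
  -- `H(x) = m⁶`
  have hI : ((x.I : ℤ) : ℝ) = m ^ 2 * ((D k).C.c τ).I := by
    have h := congrArg BinaryQuartic.I hx
    rw [I_map, eq_intCast, I_subst_of_det hγ, I_smul] at h
    exact h
  have hJ : ((x.J : ℤ) : ℝ) = m ^ 3 * ((D k).C.c τ).J := by
    have h := congrArg BinaryQuartic.J hx
    rw [J_map, eq_intCast, J_subst_of_det hγ, J_smul] at h
    exact h
  have hHx : x.height = m ^ 6 := by
    rw [height, ← realHeightIJ_intCast, hI, hJ, realHeightIJ_scale, hH1, mul_one]
  rw [hHx] at hH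
  have hX0 : 0 ≤ X := le_trans (by positivity) hH.le
  calc m = (m ^ 6) ^ (1 / 6 : ℝ) := by
        rw [← Real.rpow_natCast, ← Real.rpow_mul hm.le]; norm_num
    _ < X ^ (1 / 6 : ℝ) := Real.rpow_lt_rpow (by positivity) hH (by norm_num)

end Generic

/-! ## The pieces of the three types -/

/-- **The type-`0` piece**: the cone over `q_{1,τ}`, `τ ∈ (−2, 2)`. [cite: BhargavaShankarAnnals2015, §2.1 Table 1 (L_V^{(0)}; arXiv:1006.1002v2 numbering)] -/
theorem exists_piece0 : ∃ P : Piece, P.C = curve0 ∧ P.T = Set.Ioo (-2 : ℝ) 2 := by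
  refine ⟨⟨curve0, -2, 2, Set.Ioo (-2) 2, by norm_num, by norm_num, Set.Subset.rfl, Set.Ioo_subset_Icc_self,
    measurableSet_Ioo, fun τ _ => by rw [iota_curve0]; norm_num, ?_, ?_,
    fun m m' τ τ' hm hm' _ _ hI hJ => cone0_params_unique hm hm' hI hJ⟩, rfl, rfl⟩
  · intro τ hτ l
    have h2 : |τ| ≤ 2 := (abs_lt.2 ⟨hτ.1, hτ.2⟩).le
    fin_cases l
    · show |(0 : ℝ)| ≤ 1; simp
    · show |(1 : ℝ)| ≤ 1; simp
    · show |(0 : ℝ)| ≤ 1; simp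
    · show |(-1 / 3 : ℝ)| ≤ 1; rw [abs_le]; constructor <;> norm_num
    · show |(-τ / 27 : ℝ)| ≤ 1
      rw [abs_le]; have := abs_le.1 h2; constructor <;> linarith
  · intro τ hτ
    rw [disc_curve0]
    have : τ ^ 2 < 4 := by nlinarith [hτ.1, hτ.2]
    intro h; linarith [div_eq_zero_iff.1 h |>.resolve_right (by norm_num : (27:ℝ) ≠ 0)]

/-- `r(s) ≤ 1` and `|r(s) s| < 1` for `|s| < 2` (`r = (12 + s²)^{-1/2}`). [folklore] -/
theorem rad2_bounds (s : ℝ) : rad2 s ≤ 1 ∧ |rad2 s * s| < 1 := by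
  have hr := rad2_pos s
  have hsq := rad2_sq_mul s
  constructor
  · nlinarith [sq_nonneg s, sq_nonneg (rad2 s)]
  · rw [← sq_lt_one_iff_abs_lt_one, mul_pow]
    nlinarith [sq_nonneg s, sq_nonneg (rad2 s)]

/-- **The type-`2+` piece**: the cone over `c₂(s)`, `s ∈ (−2, 2)`. [cite: BhargavaShankarAnnals2015, §2.1 Table 1 (L_V^{(2+)}; arXiv:1006.1002v2 numbering)] -/
theorem exists_piece2 : ∃ P : Piece, P.C = curve2 ∧ P.T = Set.Ioo (-2 : ℝ) 2 := by
  refine ⟨⟨curve2, -2, 2, Set.Ioo (-2) 2, by norm_num, by norm_num, Set.Subset.rfl, Set.Ioo_subset_Icc_self,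
    measurableSet_Ioo, ?_, ?_, fun τ hτ => (disc_curve2_pos hτ).ne',
    fun m m' τ τ' hm hm' hτ hτ' hI hJ =>
      cone2_params_unique hm hm' (Set.Ioo_subset_Icc_self hτ) (Set.Ioo_subset_Icc_self hτ') hI hJ⟩, rfl, rfl⟩
  · intro s hs
    rw [iota_curve2]
    have hr := rad2_pos s
    have : s ^ 2 < 4 := by nlinarith [hs.1, hs.2]
    exact mul_ne_zero (mul_ne_zero (by norm_num) (by positivity)) (by linarith)
  · intro s _ l
    obtain ⟨h1, h2⟩ := rad2_bounds s
    have hr := rad2_pos s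
    have ha : |rad2 s| ≤ 1 := by rw [abs_of_pos hr]; exact h1
    fin_cases l
    · exact ha
    · show |(0 : ℝ)| ≤ 1; simp
    · exact h2.le
    · show |(0 : ℝ)| ≤ 1; simp
    · exact ha

/-- **The three type-`1` pieces**: the cones over `q_{−1,τ}` (`τ ∈ [−2, 2]`), `q_{τ,2}` and
`q_{τ,−2}` (`τ ∈ (−1, 1)`). [cite: BhargavaShankarAnnals2015, §2.1 Table 1 (L_V^{(1)}; arXiv:1006.1002v2 numbering)] -/
theorem exists_pieces1 : ∃ D : Fin 3 → Piece,
    ((D 0).C = curve1B ∧ (D 0).T = Set.Icc (-2 : ℝ) 2) ∧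
    ((D 1).C = curve1C ∧ (D 1).T = Set.Ioo (-1 : ℝ) 1) ∧
    ((D 2).C = curve1D ∧ (D 2).T = Set.Ioo (-1 : ℝ) 1) := by
  have hcoefB : ∀ τ ∈ Set.Icc (-2 : ℝ) 2, ∀ l, |(curve1B.c τ).coeffs l| ≤ 1 := by
    intro τ hτ l
    fin_cases l
    · show |(0 : ℝ)| ≤ 1; simp
    · show |(1 : ℝ)| ≤ 1; simp
    · show |(0 : ℝ)| ≤ 1; simp
    · show |(1 / 3 : ℝ)| ≤ 1; rw [abs_le]; constructor <;> norm_num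
    · show |(-τ / 27 : ℝ)| ≤ 1
      rw [abs_le]; constructor <;> linarith [hτ.1, hτ.2]
  have hcoefC : ∀ τ ∈ Set.Ioo (-1 : ℝ) 1, ∀ l, |(curve1C.c τ).coeffs l| ≤ 1 := by
    intro τ hτ l
    fin_cases l
    · show |(0 : ℝ)| ≤ 1; simp
    · show |(1 : ℝ)| ≤ 1; simp
    · show |(0 : ℝ)| ≤ 1; simp
    · show |(-τ / 3 : ℝ)| ≤ 1
      rw [abs_le]; constructor <;> linarith [hτ.1, hτ.2]
    · show |(-2 / 27 : ℝ)| ≤ 1; rw [abs_le]; constructor <;> norm_num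
  have hcoefD : ∀ τ ∈ Set.Ioo (-1 : ℝ) 1, ∀ l, |(curve1D.c τ).coeffs l| ≤ 1 := by
    intro τ hτ l
    fin_cases l
    · show |(0 : ℝ)| ≤ 1; simp
    · show |(1 : ℝ)| ≤ 1; simp
    · show |(0 : ℝ)| ≤ 1; simp
    · show |(-τ / 3 : ℝ)| ≤ 1
      rw [abs_le]; constructor <;> linarith [hτ.1, hτ.2]
    · show |(2 / 27 : ℝ)| ≤ 1; rw [abs_le]; constructor <;> norm_num
  have hcube : ∀ τ ∈ Set.Ioo (-1 : ℝ) 1, 4 * τ ^ 3 - 4 < 0 := by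
    intro τ hτ
    have h1 : τ ^ 3 < 1 := by
      calc τ ^ 3 ≤ |τ| ^ 3 := by
            rcases le_or_gt 0 τ with h | h
            · rw [abs_of_nonneg h]
            · have : τ ^ 3 ≤ 0 := by
                have : τ ^ 3 = τ * τ ^ 2 := by ring
                rw [this]; exact mul_nonpos_of_nonpos_of_nonneg h.le (sq_nonneg τ)
              exact this.trans (by positivity)
        _ < 1 ^ 3 := pow_lt_pow_left₀ (abs_lt.2 ⟨hτ.1, hτ.2⟩) (abs_nonneg _) (by norm_num)
        _ = 1 := by norm_num
    linarith
  have hΔB : ∀ τ ∈ Set.Icc (-2 : ℝ) 2, (curve1B.c τ).disc ≠ 0 := by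
    intro τ _ h
    rw [disc_curve1B] at h
    nlinarith [div_eq_zero_iff.1 h |>.resolve_right (by norm_num : (27:ℝ) ≠ 0), sq_nonneg τ]
  have hΔC : ∀ τ ∈ Set.Ioo (-1 : ℝ) 1, (curve1C.c τ).disc ≠ 0 := fun τ hτ => by
    rw [disc_curve1C]; exact div_ne_zero (hcube τ hτ).ne (by norm_num)
  have hΔD : ∀ τ ∈ Set.Ioo (-1 : ℝ) 1, (curve1D.c τ).disc ≠ 0 := fun τ hτ => by
    rw [disc_curve1D]; exact div_ne_zero (hcube τ hτ).ne (by norm_num)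
  let PB : Piece := ⟨curve1B, -2, 2, Set.Icc (-2) 2, by norm_num, by norm_num, Set.Ioo_subset_Icc_self, Set.Subset.rfl,
    measurableSet_Icc, fun τ _ => by rw [iota_curve1B]; norm_num, hcoefB, hΔB,
    fun m m' τ τ' hm hm' _ _ hI hJ => cone1B_params_unique hm hm' hI hJ⟩
  let PC : Piece := ⟨curve1C, -1, 1, Set.Ioo (-1) 1, by norm_num, by norm_num, Set.Subset.rfl, Set.Ioo_subset_Icc_self,
    measurableSet_Ioo, fun τ _ => by rw [iota_curve1C]; norm_num, hcoefC, hΔC,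
    fun m m' τ τ' hm hm' _ _ hI hJ => cone1C_params_unique hm hm' hI hJ⟩
  let PD : Piece := ⟨curve1D, -1, 1, Set.Ioo (-1) 1, by norm_num, by norm_num, Set.Subset.rfl, Set.Ioo_subset_Icc_self,
    measurableSet_Ioo, fun τ _ => by rw [iota_curve1D]; norm_num, hcoefD, hΔD,
    fun m m' τ τ' hm hm' _ _ hI hJ => cone1D_params_unique hm hm' hI hJ⟩
  exact ⟨![PB, PC, PD], ⟨rfl, rfl⟩, ⟨rfl, rfl⟩, ⟨rfl, rfl⟩⟩

/-! ## Type `0`: four real roots -/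

section Measure

variable [MeasurableSpace (Matrix (Fin 2) (Fin 2) ℝ)] [BorelSpace (Matrix (Fin 2) (Fin 2) ℝ)]

/-- **Upper half of Thm 2.12 for `V_ℤ^{(0)}`**: for every `ε > 0`, eventually
`N(V_ℤ^{(0)} ∩ S̃; X) ≤ (#S/N⁵ · (4/135)(π²/6) + ε) X^{5/6}`. [cite: BhargavaShankarAnnals2015, Thm 2.12 (published numbering; Thm 2.11 of arXiv v2) with Thm 2.1(a)] -/
theorem eventually_classCount_fourRealRoots_le {q : ℕ} [NeZero q] (S : Finset (Fin 5 → ZMod q))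
    (hS : ∀ f g : BinaryQuartic ℤ, GL2ZEquiv f g →
      ((fun j => ((g.coeffs j : ℤ) : ZMod q)) ∈ S ↔ (fun j => ((f.coeffs j : ℤ) : ZMod q)) ∈ S))
    {ε : ℝ} (hε : 0 < ε) :
    ∀ᶠ X : ℝ in atTop,
      (gl2zClassCount (fourRealRoots ∩ {f : BinaryQuartic ℤ | (fun j => ((f.coeffs j : ℤ) : ZMod q)) ∈ S}) X : ℝ) ≤
        ((S.card : ℝ) / (q : ℝ) ^ 5 * (4 / 135 * (π ^ 2 / 6)) + ε) * X ^ (5 / 6 : ℝ) := by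
  obtain ⟨P, hC, hT⟩ := exists_piece0
  set D : Fin 1 → Piece := fun _ => P with hD
  have hvol : volume.real (B1set D) ≤ boxHaar * 8 / 135 := by
    refine (volume_real_B1set_le D).trans ?_
    rw [Fin.sum_univ_one]
    show volume.real (psi P.C.cone '' paramBox P.T) ≤ _
    rw [hC, hT, Measure.real, volume_image_psi_cone0, ENNReal.toReal_ofReal (by have := boxHaar_pos; positivity)]
    linarith
  have h := eventually_classCount_le_of_pieces D (fun X _ => isSectionSet_sections_one P X)
    (Vset := fourRealRoots) (fun f g h => h.mem_fourRealRoots_iff)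
    ?_ (nR := 8) (by norm_num) ?_ hvol S hS ε hε
  · refine h.mono fun X hX => hX.trans (le_of_eq ?_)
    have hb := boxHaar_pos
    congr 1
    push_cast
    field_simp
    ring
  · -- coverage
    intro X _ x hx _ hH
    obtain ⟨hΔ, hnd⟩ := hx
    have hΔ' : 0 < (x.map (Int.castRingHom ℝ)).disc := by rw [disc_map, eq_intCast]; exact_mod_cast hΔ
    obtain ⟨m, τ, hm, hτ, γ, hγ, hxe⟩ := exists_cone0_subst hΔ' hnd
    have hτ' : τ ∈ (D 0).T := by show τ ∈ P.T; rw [hT]; exact hτ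
    refine exists_section_of_cone D (k := 0) hm hτ' hγ (by rw [hxe]; show _ = (m • P.C.c τ).subst γ; rw [hC]) ?_ hH
    show realHeightIJ (P.C.c τ).I (P.C.c τ).J = 1
    rw [hC]; exact realHeightIJ_curve0 (abs_lt.2 ⟨hτ.1, hτ.2⟩).le
  · -- stabilisers
    intro X _
    refine eight_le_ncard_substStabilizer D (fun k τ hτ => ?_) X
    have hτ' : τ ∈ Set.Ioo (-2 : ℝ) 2 := by have : τ ∈ P.T := hτ; rwa [hT] at this
    show 0 < (P.C.c τ).disc
    rw [hC, disc_curve0]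
    have : τ ^ 2 < 4 := by nlinarith [hτ'.1, hτ'.2]
    have : 0 < 4 - τ ^ 2 := by linarith
    positivity

/-! ## Type `2+`: positive definite forms -/

/-- **Upper half of Thm 2.12 for `V_ℤ^{(2+)}`**: for every `ε > 0`, eventually
`N(V_ℤ^{(2+)} ∩ S̃; X) ≤ (#S/N⁵ · (4/135)(π²/6) + ε) X^{5/6}`. [cite: BhargavaShankarAnnals2015, Thm 2.12 (published numbering) with Thm 2.1(c) (one half of N(V^{(2)};X))] -/
theorem eventually_classCount_posDefinite_le {q : ℕ} [NeZero q] (S : Finset (Fin 5 → ZMod q))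
    (hS : ∀ f g : BinaryQuartic ℤ, GL2ZEquiv f g →
      ((fun j => ((g.coeffs j : ℤ) : ZMod q)) ∈ S ↔ (fun j => ((f.coeffs j : ℤ) : ZMod q)) ∈ S))
    {ε : ℝ} (hε : 0 < ε) :
    ∀ᶠ X : ℝ in atTop,
      (gl2zClassCount (posDefinite ∩ {f : BinaryQuartic ℤ | (fun j => ((f.coeffs j : ℤ) : ZMod q)) ∈ S}) X : ℝ) ≤
        ((S.card : ℝ) / (q : ℝ) ^ 5 * (4 / 135 * (π ^ 2 / 6)) + ε) * X ^ (5 / 6 : ℝ) := by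
  obtain ⟨P, hC, hT⟩ := exists_piece2
  set D : Fin 1 → Piece := fun _ => P with hD
  have hvol : volume.real (B1set D) ≤ boxHaar * 8 / 135 := by
    refine (volume_real_B1set_le D).trans ?_
    rw [Fin.sum_univ_one]
    show volume.real (psi P.C.cone '' paramBox P.T) ≤ _
    rw [hC, hT, Measure.real, volume_image_psi_cone2, ENNReal.toReal_ofReal (by have := boxHaar_pos; positivity)]
    linarith
  have h := eventually_classCount_le_of_pieces D (fun X _ => isSectionSet_sections_one P X)
    (Vset := posDefinite) (fun f g h => h.mem_posDefinite_iff)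
    ?_ (nR := 8) (by norm_num) ?_ hvol S hS ε hε
  · refine h.mono fun X hX => hX.trans (le_of_eq ?_)
    have hb := boxHaar_pos
    congr 1
    push_cast
    field_simp
    ring
  · -- coverage
    intro X _ x hx hirr hH
    have hΔ' : (x.map (Int.castRingHom ℝ)).disc ≠ 0 := by
      rw [disc_map, eq_intCast]; exact_mod_cast disc_ne_zero_of_isIrreducible hirr
    obtain ⟨m, s, hm, hs, γ, hγ, hxe⟩ := exists_cone2_subst hΔ' hx
    have hs' : s ∈ (D 0).T := by show s ∈ P.T; rw [hT]; exact hs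
    refine exists_section_of_cone D (k := 0) hm hs' (Or.inl hγ) (by rw [hxe]; show _ = (m • P.C.c s).subst γ; rw [hC]) ?_ hH
    show realHeightIJ (P.C.c s).I (P.C.c s).J = 1
    rw [hC]; exact realHeightIJ_curve2 (Set.Ioo_subset_Icc_self hs)
  · -- stabilisers
    intro X _
    refine eight_le_ncard_substStabilizer D (fun k τ hτ => ?_) X
    have hτ' : τ ∈ Set.Ioo (-2 : ℝ) 2 := by have : τ ∈ P.T := hτ; rwa [hT] at this
    show 0 < (P.C.c τ).disc
    rw [hC]; exact disc_curve2_pos hτ'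

/-! ## Type `1`: two real roots -/

/-- **Upper half of Thm 2.12 for `V_ℤ^{(1)}`**: for every `ε > 0`, eventually
`N(V_ℤ^{(1)} ∩ S̃; X) ≤ (#S/N⁵ · (32/135)(π²/6) + ε) X^{5/6}`. [cite: BhargavaShankarAnnals2015, Thm 2.12 (published numbering) with Thm 2.1(b)] -/
theorem eventually_classCount_twoRealRoots_le {q : ℕ} [NeZero q] (S : Finset (Fin 5 → ZMod q))
    (hS : ∀ f g : BinaryQuartic ℤ, GL2ZEquiv f g →
      ((fun j => ((g.coeffs j : ℤ) : ZMod q)) ∈ S ↔ (fun j => ((f.coeffs j : ℤ) : ZMod q)) ∈ S))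
    {ε : ℝ} (hε : 0 < ε) :
    ∀ᶠ X : ℝ in atTop,
      (gl2zClassCount (twoRealRoots ∩ {f : BinaryQuartic ℤ | (fun j => ((f.coeffs j : ℤ) : ZMod q)) ∈ S}) X : ℝ) ≤
        ((S.card : ℝ) / (q : ℝ) ^ 5 * (32 / 135 * (π ^ 2 / 6)) + ε) * X ^ (5 / 6 : ℝ) := by
  obtain ⟨D, ⟨hC0, hT0⟩, ⟨hC1, hT1⟩, ⟨hC2, hT2⟩⟩ := exists_pieces1
  have hb := boxHaar_pos
  -- volume
  have hvol : volume.real (B1set D) ≤ boxHaar * 32 / 135 := by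
    refine (volume_real_B1set_le D).trans ?_
    rw [Fin.sum_univ_three, hC0, hT0, hC1, hT1, hC2, hT2, Measure.real, Measure.real, Measure.real,
      volume_image_psi_cone1B, volume_image_psi_cone1C, volume_image_psi_cone1D,
      ENNReal.toReal_ofReal (by positivity : (0:ℝ) ≤ 1 / 27 * boxHaar * (8 / 5)),
      ENNReal.toReal_ofReal (by positivity : (0:ℝ) ≤ 1 / 27 * boxHaar * (12 / 5))]
    linarith
  -- separation of the three pieces by invariants: the index is a function of `(I, J)`
  obtain ⟨idx, hidx⟩ : ∃ idx : ℝ → ℝ → Fin 3, idx = fun I J => if J ^ 2 ≤ 4 * |I| ^ 3 then 0 else if 0 < J then 1 else 2 :=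
    ⟨_, rfl⟩
  have key0 : ∀ m τ : ℝ, 0 < m → τ ∈ (D 0).T → (0 : Fin 3) = idx (m • (D 0).C.c τ).I (m • (D 0).C.c τ).J := by
    intro m τ hm hτ
    rw [hT0] at hτ
    rw [hC0, hidx]; dsimp only
    rw [if_pos (cone1B_invariants m hτ)]
  have key1 : ∀ m τ : ℝ, 0 < m → τ ∈ (D 1).T → (1 : Fin 3) = idx (m • (D 1).C.c τ).I (m • (D 1).C.c τ).J := by
    intro m τ hm hτ
    rw [hT1] at hτ
    obtain ⟨h1, h2⟩ := cone1C_invariants hm hτ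
    rw [hC1, hidx]; dsimp only
    rw [if_neg (not_le.2 h1), if_pos h2]
  have key2 : ∀ m τ : ℝ, 0 < m → τ ∈ (D 2).T → (2 : Fin 3) = idx (m • (D 2).C.c τ).I (m • (D 2).C.c τ).J := by
    intro m τ hm hτ
    rw [hT2] at hτ
    obtain ⟨h1, h2⟩ := cone1D_invariants hm hτ
    rw [hC2, hidx]; dsimp only
    rw [if_neg (not_le.2 h1), if_neg (not_lt.2 h2.le)]
  have key : ∀ (k : Fin 3) (m τ : ℝ), 0 < m → τ ∈ (D k).T → k = idx (m • (D k).C.c τ).I (m • (D k).C.c τ).J := by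
    intro k
    fin_cases k
    · exact key0
    · exact key1
    · exact key2
  have hsep : ∀ (k k' : Fin 3) (m m' τ τ' : ℝ), 0 < m → 0 < m' → τ ∈ (D k).T → τ' ∈ (D k').T →
      (m • (D k).C.c τ).I = (m' • (D k').C.c τ').I → (m • (D k).C.c τ).J = (m' • (D k').C.c τ').J → k = k' := by
    intro k k' m m' τ τ' hm hm' hτ hτ' hI hJ
    have a := key k m τ hm hτ
    have b := key k' m' τ' hm' hτ'
    rw [hI, hJ] at a
    exact a.trans b.symm
  -- negative discriminant on all three pieces
  have hcube : ∀ τ ∈ Set.Ioo (-1 : ℝ) 1, 4 * τ ^ 3 - 4 < 0 := by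
    intro τ hτ
    have h1 : τ ^ 3 < 1 := by
      calc τ ^ 3 ≤ |τ| ^ 3 := by
            rcases le_or_gt 0 τ with h | h
            · rw [abs_of_nonneg h]
            · have e : τ ^ 3 = τ * τ ^ 2 := by ring
              have : τ ^ 3 ≤ 0 := by rw [e]; exact mul_nonpos_of_nonpos_of_nonneg h.le (sq_nonneg τ)
              exact this.trans (by positivity)
        _ < 1 ^ 3 := pow_lt_pow_left₀ (abs_lt.2 ⟨hτ.1, hτ.2⟩) (abs_nonneg _) (by norm_num)
        _ = 1 := by norm_num
    linarith
  have neg0 : ∀ τ ∈ (D 0).T, ((D 0).C.c τ).disc < 0 := by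
    intro τ _
    rw [hC0, disc_curve1B]
    have : 0 < 4 + τ ^ 2 := by positivity
    apply div_neg_of_neg_of_pos _ (by norm_num); linarith
  have neg1 : ∀ τ ∈ (D 1).T, ((D 1).C.c τ).disc < 0 := by
    intro τ hτ
    rw [hT1] at hτ
    rw [hC1, disc_curve1C]
    exact div_neg_of_neg_of_pos (hcube τ hτ) (by norm_num)
  have neg2 : ∀ τ ∈ (D 2).T, ((D 2).C.c τ).disc < 0 := by
    intro τ hτ
    rw [hT2] at hτ
    rw [hC2, disc_curve1D]
    exact div_neg_of_neg_of_pos (hcube τ hτ) (by norm_num)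
  have hneg : ∀ (k : Fin 3), ∀ τ ∈ (D k).T, ((D k).C.c τ).disc < 0 := by
    intro k
    fin_cases k
    · exact neg0
    · exact neg1
    · exact neg2
  have h := eventually_classCount_le_of_pieces D (fun X _ => isSectionSet_sections_of_sep D hsep X)
    (Vset := twoRealRoots) (fun f g h => h.mem_twoRealRoots_iff)
    ?_ (nR := 4) (by norm_num) ?_ hvol S hS ε hε
  · refine h.mono fun X hX => hX.trans (le_of_eq ?_)
    congr 1
    push_cast
    field_simp
    ring
  · -- coverage
    intro X _ x hx _ hH
    have hΔ' : (x.map (Int.castRingHom ℝ)).disc < 0 := by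
      rw [disc_map, eq_intCast]; exact_mod_cast (show x.disc < 0 from hx)
    rcases exists_cone1_subst hΔ' with ⟨m, τ, hm, hτ, γ, hγ, hxe⟩ | ⟨m, τ, hm, hτ, γ, hγ, hxe⟩ | ⟨m, τ, hm, hτ, γ, hγ, hxe⟩
    · have hτ' : τ ∈ (D 0).T := by rw [hT0]; exact hτ
      refine exists_section_of_cone D hm hτ' hγ (by rw [hxe, hC0]) ?_ hH
      rw [hC0]; exact realHeightIJ_curve1B (abs_le.2 ⟨hτ.1, hτ.2⟩)
    · have hτ' : τ ∈ (D 1).T := by rw [hT1]; exact hτ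
      refine exists_section_of_cone D hm hτ' hγ (by rw [hxe, hC1]) ?_ hH
      rw [hC1]; exact realHeightIJ_curve1C (abs_lt.2 ⟨hτ.1, hτ.2⟩).le
    · have hτ' : τ ∈ (D 2).T := by rw [hT2]; exact hτ
      refine exists_section_of_cone D hm hτ' hγ (by rw [hxe, hC2]) ?_ hH
      rw [hC2]; exact realHeightIJ_curve1D (abs_lt.2 ⟨hτ.1, hτ.2⟩).le
  · -- stabilisers
    intro X _
    exact four_le_ncard_substStabilizer D hneg X

end Measure

/-! ## Thm 2.12 (upper halves) and Cor. 1.2 from the local integrals -/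

/-- **Bhargava–Shankar, Thm 2.12, upper halves for the three types** (the hypothesis (D_T) of
`averageRankLE_three_halves_of_upperCongruenceTypeCount`): for every modulus `N`, every set
`S ⊆ (ℤ/Nℤ)⁵` of residues with `GL₂(ℤ)`-invariant pull-back `S̃` and every `ε > 0`, eventually in
`X`, `N(V_ℤ^{(0)} ∩ S̃; X) ≤ (#S/N⁵·(4/135)ζ(2)·… + ε)X^{5/6}` (with `π²/6` for `ζ(2)`),
`N(V_ℤ^{(2+)} ∩ S̃; X) ≤ (#S/N⁵·(4/135)(π²/6) + ε)X^{5/6}`,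
`N(V_ℤ^{(1)} ∩ S̃; X) ≤ (#S/N⁵·(32/135)(π²/6) + ε)X^{5/6}`.
[cite: BhargavaShankarAnnals2015, Thm 2.12 (published numbering; = Thm 2.11 of arXiv:1006.1002v2), upper bound, with the constants of Thm 2.1] -/
theorem upperCongruenceTypeCount (N : ℕ) [NeZero N] (S : Finset (Fin 5 → ZMod N))
    (hS : ∀ f g : BinaryQuartic ℤ, GL2ZEquiv f g →
      ((fun j => ((g.coeffs j : ℤ) : ZMod N)) ∈ S ↔ (fun j => ((f.coeffs j : ℤ) : ZMod N)) ∈ S))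
    (ε : ℝ) (hε : 0 < ε) :
    ∀ᶠ X : ℝ in atTop,
      (gl2zClassCount (fourRealRoots ∩
          {f : BinaryQuartic ℤ | (fun j => ((f.coeffs j : ℤ) : ZMod N)) ∈ S}) X : ℝ) ≤
        ((S.card : ℝ) / (N : ℝ) ^ 5 * (4 / 135 * (Real.pi ^ 2 / 6)) + ε) * X ^ (5 / 6 : ℝ) ∧
      (gl2zClassCount (posDefinite ∩
          {f : BinaryQuartic ℤ | (fun j => ((f.coeffs j : ℤ) : ZMod N)) ∈ S}) X : ℝ) ≤
        ((S.card : ℝ) / (N : ℝ) ^ 5 * (4 / 135 * (Real.pi ^ 2 / 6)) + ε) * X ^ (5 / 6 : ℝ) ∧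
      (gl2zClassCount (twoRealRoots ∩
          {f : BinaryQuartic ℤ | (fun j => ((f.coeffs j : ℤ) : ZMod N)) ∈ S}) X : ℝ) ≤
        ((S.card : ℝ) / (N : ℝ) ^ 5 * (32 / 135 * (Real.pi ^ 2 / 6)) + ε) * X ^ (5 / 6 : ℝ) := by
  letI : MeasurableSpace (Matrix (Fin 2) (Fin 2) ℝ) := borel _
  haveI : BorelSpace (Matrix (Fin 2) (Fin 2) ℝ) := ⟨rfl⟩
  exact ((eventually_classCount_fourRealRoots_le S hS hε).and
    ((eventually_classCount_posDefinite_le S hS hε).and (eventually_classCount_twoRealRoots_le S hS hε)))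

open scoped Classical in
/-- **Bhargava–Shankar, Cor. 1.2, from the local integrals alone**: if for every prime `p`
`∫_{V_{ℤ_p}} φ_p dμ_p = |2¹⁰/3³|_p · localMassV p` (Prop. 3.13, with
`localMassV p = Vol(PGL₂(ℤ_p)) · M_p(V,F)`), then the `limsup` of the average rank of elliptic
curves over `ℚ` ordered by height is at most `3/2` (`averageRankLE_three_halves`).
[cite: BhargavaShankarAnnals2015, Cor. 1.2 (with Thm 2.12 proved here in its upper half and Prop. 3.13 as hypothesis)] -/
theorem averageRankLE_three_halves_of_localIntegrals
    (hF : ∀ (p : ℕ) [Fact p.Prime],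
      ∫ f : BinaryQuartic ℤ_[p],
          (if (f.map PadicInt.Coe.ringHom).IsSoluble ∧
              (∃ IJ ∈ invariantPairsAdic p, f.I = 2 ^ 4 * IJ.1 ∧ f.J = 2 ^ 6 * IJ.2)
            then (1 : ℝ) / localWeight f else 0) =
        ((padicNorm p (2 ^ 10 / 3 ^ 3) : ℚ) : ℝ) * localMassV p) :
    averageRankLE_three_halves :=
  averageRankLE_three_halves_of_upperCongruenceTypeCount
    (fun N _ S hS ε hε => upperCongruenceTypeCount N S hS ε hε) hF

open scoped Classical in
/-- **Cor. 1.2 from Prop. 3.13 in its printed set-integral form**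
`∫_{S_p(F)} 1/m_p(f) df = |2¹⁰/3³|_p · localMassV p` for every prime `p`.
[cite: BhargavaShankarAnnals2015, Cor. 1.2 and Prop. 3.13 (published numbering)] -/
theorem averageRankLE_three_halves_of_localIntegrals_setIntegral
    (hF : ∀ (p : ℕ) [Fact p.Prime],
      ∫ f in {f : BinaryQuartic ℤ_[p] | (f.map PadicInt.Coe.ringHom).IsSoluble ∧
          (∃ IJ ∈ invariantPairsAdic p, f.I = 2 ^ 4 * IJ.1 ∧ f.J = 2 ^ 6 * IJ.2)},
        (1 : ℝ) / localWeight f =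
        ((padicNorm p (2 ^ 10 / 3 ^ 3) : ℚ) : ℝ) * localMassV p) :
    averageRankLE_three_halves :=
  averageRankLE_three_halves_of_upperCongruenceTypeCount_setIntegral
    (fun N _ S hS ε hε => upperCongruenceTypeCount N S hS ε hε) hF

end BinaryQuartic

end Literature.NumberTheory.EllipticCurves

end
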